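import Literature.NumberTheory.Transcendental.SEACIsolation
import Literature.NumberTheory.Transcendental.ZilberFieldExistenceChart
import Literature.ModelTheory.Quasiminimal.OrbitLanguage
import Literature.ModelTheory.Quasiminimal.ContinuumModel
import HarnessLib

/-!
# The quasiminimal chart of a countable strongly exponentially-algebraically closed field, and
Zilber's existence theorem from one countable model

M. Bays, J. Kirby, *Pseudo-exponential maps, variants, and quasiminimality*, Algebra & Number
Theory 12 (2018), Thm 6.9: the countable models are quasiminimal pregeometry structures (Def. 6.1,
QM1–QM5) for the localised closure `C ↦ ecl (S ∪ C)` (Remark 10.10) in a language in which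
quantifier-free types are Galois types (Remark 6.6) — here the orbit language of
`Aut(M / ecl S)` (`Literature/ModelTheory/Quasiminimal/OrbitLanguage.lean`, `SEACModel.baseAut`).
The verifications of the individual axioms for a countable algebraically closed exponential field
`M` with surjective `exp` which is strongly exponentially-algebraically closed and infinite
dimensional are in the tree (`SEACOrbits.lean`: QM1, the pregeometry, uniqueness of the generic
type over finite sets; `SEACNonSplitting.lean`, `SEACIsolation.lean`: QM5 over closed sets). This
file ASSEMBLES them:

* `SEACModel.isWeaklyQuasiminimalPregeometryStructure_orbit`,
  `SEACModel.isQuasiminimalPregeometryStructure_orbit` — Thm 6.9: `M` is a quasiminimal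
  pregeometry structure in the orbit language of `Aut(M / ecl S)` (`S` finite) for
  `C ↦ ecl (S ∪ C)` (QM4 over countable closed `H` reduces to the finite case because `a ∉ H`
  means `a ∉ ecl (S ∪ s̄)` for every finite `s̄ ⊆ H`; QM5 over `∅` is immediate for Galois types);
* `SEACModel.exists_orbitBasis` — a basis indexed by `ℕ ⊕ (ℕ ⊕ ℕ)` (a base of the pregeometry,
  `IsPregeometry.exists_indepFamilyOver`, is countably infinite by infinite dimension);
* `SEACModel.exists_expRingHom_of_isQFEmbOn`, `SEACModel.expRing_eqQFType_of_eqQFType` — partial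
  embeddings of the orbit language are locally automorphisms of the exponential field, hence
  E-ring endomorphisms, and conjugate tuples have the same quantifier-free type in the language
  of exponential rings;
* `SEACModel.nonempty_orbitSetup` — whence the chart `Setup (orbitLanguage M) M (ecl (S ∪ ·))` of
  `Literature/ModelTheory/Quasiminimal/ContinuumModel.lean` (the input of the constructions of
  models of cardinality `𝔠`, `ContinuumAssembly.lean`, and of every infinite cardinality,
  `KappaModel.lean`/`KappaAxioms.lean`, along Kirby 2010, Thm 4.2);
* `exists_isZilberField_of_aleph0_lt_of_countable` — **Zilber's existence theorem from one
  countable model**: a countable algebraically closed exponential field with surjective `exp`,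
  standard kernel, the Schanuel property, strong exponential-algebraic closedness and infinite
  `ecl`-dimension yields a Zilber field of every uncountable cardinality (with
  `exists_isZilberField_of_aleph0_lt_of_orbitSetup` of `ZilberFieldExistenceChart.lean`). This is
  exactly the passage "countable model `M(SK)` (Thm 5.9) ⟹ Thm 6.9 ⟹ Fact 6.4 ⟹ Thm 8.2 ⟹
  Thm 9.1" of Bays–Kirby's proof of Zilber 2005, Thm 1.1; what remains is the countable model.

Everything is proved; no definition or named fact is introduced (the chart is produced as
`Nonempty (Setup …)`).

## References

* M. Bays, J. Kirby, *Pseudo-exponential maps, variants, and quasiminimality*, Algebra & Number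
  Theory 12 (2018) 493–549: Def. 6.1, Fact 6.4, Remark 6.6, Thm 6.9, Thm 8.2, Thm 9.1,
  Remark 10.10.
* M. Bays, B. Hart, T. Hyttinen, M. Kesälä, J. Kirby, *Quasiminimal structures and excellence*,
  Bull. LMS 46 (2014): Def. 2.1, Cor. 5.3.
* J. Kirby, *On quasiminimal excellent classes*, J. Symbolic Logic 75 (2010): Thm 4.2.
* B. Zilber, *Pseudo-exponentiation on algebraically closed fields of characteristic zero*,
  Ann. Pure Appl. Logic 132 (2005): Thm 1.1.
-/

noncomputable section

suppress_compilation

open Set Cardinal FirstOrder FirstOrder.Language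
open Literature.ModelTheory.ExponentialFields Literature.ModelTheory.ExponentialFields.ExponentialRing
open Literature.ModelTheory.Quasiminimal

namespace Literature.NumberTheory.Transcendental

namespace SEACModel

variable {M : Type} [Field M] [Literature.ModelTheory.ExponentialFields.ExponentialRing M]

/-- Splitting `σ ∘ Fin.snoc b a = Fin.snoc b' a'`. [folklore] -/
theorem comp_snoc_eq_snoc_iff {N : Type*} {n : ℕ} {σ : N → N} {b b' : Fin n → N} {a a' : N} :
    σ ∘ (Fin.snoc b a : Fin (n + 1) → N) = Fin.snoc b' a' ↔ σ ∘ b = b' ∧ σ a = a' := by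
  rw [Fin.comp_snoc]
  constructor
  · intro h
    refine ⟨?_, ?_⟩
    · funext i
      have := congrFun h (Fin.castSucc i)
      simpa only [Fin.snoc_castSucc] using this
    · have := congrFun h (Fin.last n)
      simpa only [Fin.snoc_last] using this
  · rintro ⟨h₁, h₂⟩
    rw [h₁, h₂]

/-! ### Automorphisms and the language of exponential rings -/

/-- An automorphism of the exponential field is an isomorphism of `Language.expRing`-structures,
so conjugate tuples have the same quantifier-free type in the language of exponential rings.
[folklore] -/
theorem expRing_eqQFType_comp_equiv {α : Type*} (ρ : ExponentialRingEquiv M M) (x : α → M) :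
    Language.expRing.EqQFType x (ρ ∘ x) := by
  let e : M ≃[Language.expRing] M :=
    { toEquiv := toPerm ρ
      map_fun' := by
        intro n f v
        cases f <;> simp [map_add, map_mul, map_neg, map_zero, map_one]
      map_rel' := by
        intro n r v
        exact r.elim }
  intro φ _
  exact (StrongHomClass.realize_formula e φ (v := x)).symm

section Orbit

variable [Γ : OrbitGroup M] {S : Set M}

/-- **Conjugate tuples have the same quantifier-free `(+, ·, exp)`-type**: in the orbit language
of a group `G ≤ Aut(M / ecl S)`, equality of quantifier-free types implies equality of
quantifier-free types in the language of exponential rings. [cite: BaysKirby2018ANT, Remark 6.6] -/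
theorem expRing_eqQFType_of_eqQFType (hΓ : Γ.G ≤ baseAut S) {n : ℕ} {x y : Fin n → M}
    (h : (orbitLanguage M).EqQFType x y) : Language.expRing.EqQFType x y := by
  obtain ⟨g, hg, hgx⟩ := (eqQFType_iff_exists x y).1 h
  obtain ⟨ρ, hρ⟩ := exists_equiv_of_mem_baseAut (hΓ hg)
  have : y = ρ ∘ x := by rw [hρ, hgx]
  rw [this]
  exact expRing_eqQFType_comp_equiv ρ x

/-- **Partial embeddings of the orbit language are E-ring endomorphisms**: a map which is locally
in `G ≤ Aut(M / ecl S)` (`isQFEmbOn_iff`) preserves `0, 1, +, ·` and `exp`.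
[cite: BaysKirby2018ANT, Remark 6.6] -/
theorem exists_expRingHom_of_isQFEmbOn (hΓ : Γ.G ≤ baseAut S) {σ : M → M}
    (hσ : IsQFEmbOn (orbitLanguage M) σ Set.univ) :
    ∃ e : ExponentialRingHom M M, ⇑e = σ := by
  have key : ∀ {n : ℕ} (x : Fin n → M), ∃ ρ : ExponentialRingEquiv M M, ∀ i, ρ (x i) = σ (x i) := by
    intro n x
    obtain ⟨g, hg, hgx⟩ := (isQFEmbOn_iff (Γ := Γ)).1 hσ x (fun _ => Set.mem_univ _)
    obtain ⟨ρ, hρ⟩ := exists_equiv_of_mem_baseAut (hΓ hg)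
    exact ⟨ρ, fun i => (congrFun hρ (x i)).trans (congrFun hgx i)⟩
  have h1 : σ 1 = 1 := by
    obtain ⟨ρ, hρ⟩ := key ![1]
    have e0 : ρ 1 = σ 1 := hρ 0
    rw [← e0, map_one]
  have h0 : σ 0 = 0 := by
    obtain ⟨ρ, hρ⟩ := key ![0]
    have e0 : ρ 0 = σ 0 := hρ 0
    rw [← e0, map_zero]
  have hmul : ∀ x y, σ (x * y) = σ x * σ y := by
    intro x y
    obtain ⟨ρ, hρ⟩ := key ![x, y, x * y]
    have e0 : ρ x = σ x := hρ 0
    have e1 : ρ y = σ y := hρ 1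
    have e2 : ρ (x * y) = σ (x * y) := hρ 2
    rw [← e0, ← e1, ← e2, map_mul]
  have hadd : ∀ x y, σ (x + y) = σ x + σ y := by
    intro x y
    obtain ⟨ρ, hρ⟩ := key ![x, y, x + y]
    have e0 : ρ x = σ x := hρ 0
    have e1 : ρ y = σ y := hρ 1
    have e2 : ρ (x + y) = σ (x + y) := hρ 2
    rw [← e0, ← e1, ← e2, map_add]
  have hexp : ∀ x, σ (exp x) = exp (σ x) := by
    intro x
    obtain ⟨ρ, hρ⟩ := key ![x, exp x]
    have e0 : ρ x = σ x := hρ 0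
    have e1 : ρ (exp x) = σ (exp x) := hρ 1
    rw [← e0, ← e1, ρ.map_exp]
  exact ⟨{ toFun := σ, map_one' := h1, map_mul' := hmul, map_zero' := h0, map_add' := hadd,
           map_exp' := hexp }, rfl⟩

variable [CharZero M] [IsAlgClosed M] [Countable M]

/-- **Bays–Kirby 2018, Thm 6.9 (weak form: QM1, QM3, QM4, QM5)**: a countable algebraically
closed exponential field with surjective `exp` which is strongly exponentially-algebraically
closed and infinite dimensional is a weakly quasiminimal pregeometry structure for the localised
closure `C ↦ ecl (S ∪ C)` (`S` finite) in the orbit language of `Aut(M / ecl S)`. QM1: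
`SEACModel.apply_mem_ecl_union_range_iff`; QM3: `M` is countable; QM4: over a countable closed
`H`, `a ∉ H` gives `a ∉ ecl (S ∪ s̄)` for all finite `s̄ ⊆ H` and one applies uniqueness of the
generic type over finite sets (`SEACModel.exists_mem_baseAut_apply_eq_of_notMem`); QM5 over closed
sets: `SEACModel.homogeneity_over_closed`; QM5 over `∅`: Galois types are orbits.
[cite: BaysKirby2018ANT, Thm 6.9] -/
theorem isWeaklyQuasiminimalPregeometryStructure_orbit (hΓ : Γ.G = baseAut S) (hS : S.Finite)
    (hsurj : IsSurjectiveOntoUnits M) (hSEAC : IsStronglyExpAlgClosed M)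
    (hinf : ∀ C : Set M, C.Finite → ∃ d, d ∉ ecl C) :
    IsWeaklyQuasiminimalPregeometryStructure (orbitLanguage M) M (fun C : Set M => ecl (S ∪ C)) where
  isPregeometry := isPregeometry_ecl_union S
  mem_cl_of_eqQFType := by
    intro n b b' a a' h ha
    obtain ⟨σ, hσ, hσe⟩ := (eqQFType_iff_exists _ _).1 h
    rw [hΓ] at hσ
    obtain ⟨hb, hab⟩ := comp_snoc_eq_snoc_iff.1 hσe
    rw [← hab]
    exact (apply_mem_ecl_union_range_iff hσ hb a).2 ha
  countable_cl := fun A _ => Set.to_countable _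
  uniqueness_of_generic_type := by
    intro H f _ hH hfH h0 a a' ha ha'
    rw [eqQFTypeOver_iff] at h0 ⊢
    intro m s hs
    obtain ⟨σ₀, hσ₀, hσ₀s, -⟩ := h0 s hs
    have hσ₀' : σ₀ ∈ baseAut S := by rw [← hΓ]; exact hσ₀
    have ha₁ : a ∉ ecl (S ∪ range s) := fun h =>
      ha (ecl_union_subset_of_closed hH (Set.range_subset_iff.2 hs) h)
    have ha₂ : σ₀ a ∉ ecl (S ∪ range (f ∘ s)) := fun h =>
      ha₁ ((apply_mem_ecl_union_range_iff hσ₀' hσ₀s a).1 h)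
    have hfs : range (f ∘ s) ⊆ f '' H := by
      rintro _ ⟨i, rfl⟩
      exact ⟨s i, hs i, rfl⟩
    have ha₃ : a' ∉ ecl (S ∪ range (f ∘ s)) := fun h =>
      ha' (ecl_union_subset_of_closed hfH hfs h)
    obtain ⟨g, hg, hgfix, hga⟩ :=
      exists_mem_baseAut_apply_eq_of_notMem hsurj hSEAC hinf hS (f ∘ s) ha₂ ha₃
    have hg' : g ∈ Γ.G := by rw [hΓ]; exact hg
    refine ⟨g * σ₀, Γ.G.mul_mem hg' hσ₀, ?_, ?_⟩
    · funext i
      have hi : σ₀ (s i) = f (s i) := congrFun hσ₀s i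
      simp only [Function.comp_apply, Equiv.Perm.mul_apply, hi]
      exact hgfix i
    · funext i
      fin_cases i
      simp [hga]
  homogeneity_over_closed := by
    intro H f _ hH n b b' hbb' a ha
    rw [eqQFTypeOver_iff] at hbb'
    have hloc : ∀ ⦃m : ℕ⦄ (s : Fin m → M), (∀ i, s i ∈ H) →
        ∃ ρ ∈ baseAut S, ⇑ρ ∘ s = f ∘ s ∧ ⇑ρ ∘ b = b' := by
      intro m s hs
      obtain ⟨ρ, hρ, h₁, h₂⟩ := hbb' s hs
      exact ⟨ρ, hΓ ▸ hρ, h₁, h₂⟩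
    rcases hH with ⟨hH, -⟩ | rfl
    · obtain ⟨a', ha'⟩ := homogeneity_over_closed hsurj hSEAC hinf hS hH f hloc ha
      refine ⟨a', ?_⟩
      rw [eqQFTypeOver_iff]
      intro m s hs
      obtain ⟨ρ, hρ, h₁, h₂, h₃⟩ := ha' s hs
      exact ⟨ρ, hΓ ▸ hρ, h₁, comp_snoc_eq_snoc_iff.2 ⟨h₂, h₃⟩⟩
    · obtain ⟨ρ, hρ, -, h₂⟩ := hloc (Fin.elim0 : Fin 0 → M) (fun i => i.elim0)
      refine ⟨ρ a, ?_⟩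
      rw [eqQFTypeOver_iff]
      intro m s hs
      refine ⟨ρ, hΓ ▸ hρ, ?_, comp_snoc_eq_snoc_iff.2 ⟨h₂, rfl⟩⟩
      funext i
      exact (hs i).elim

/-- **Bays–Kirby 2018, Thm 6.9**: with QM2 (infinite dimension) as well, `M` is a quasiminimal
pregeometry structure in the orbit language of `Aut(M / ecl S)`. [cite: BaysKirby2018ANT, Thm 6.9] -/
theorem isQuasiminimalPregeometryStructure_orbit (hΓ : Γ.G = baseAut S) (hS : S.Finite)
    (hsurj : IsSurjectiveOntoUnits M) (hSEAC : IsStronglyExpAlgClosed M)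
    (hinf : ∀ C : Set M, C.Finite → ∃ d, d ∉ ecl C) :
    IsQuasiminimalPregeometryStructure (orbitLanguage M) M (fun C : Set M => ecl (S ∪ C)) where
  toIsWeaklyQuasiminimalPregeometryStructure :=
    isWeaklyQuasiminimalPregeometryStructure_orbit hΓ hS hsurj hSEAC hinf
  cl_ne_univ := by
    intro A hA h
    obtain ⟨d, hd⟩ := hinf (S ∪ A) (hS.union hA)
    exact hd (h.symm ▸ Set.mem_univ d)

end Orbit

/-! ### A countable basis -/

section Basis

variable [Countable M] {S : Set M}

/-- **A basis of the localised pregeometry indexed by `ℕ ⊕ (ℕ ⊕ ℕ)`**: a base of the pregeometry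
`C ↦ ecl (S ∪ C)` (`IsPregeometry.exists_indepFamilyOver`) is infinite when no finite set spans
(`S` finite), and countable, so it can be enumerated by any countably infinite type.
[cite: BaysKirby2018ANT, Fact 6.4 (proof)] -/
theorem exists_orbitBasis (hS : S.Finite) (hinf : ∀ C : Set M, C.Finite → ∃ d, d ∉ ecl C) :
    ∃ b : ℕ ⊕ (ℕ ⊕ ℕ) → M, IndepFamilyOver (fun C : Set M => ecl (S ∪ C)) ∅ b ∧
      ecl (S ∪ range b) = Set.univ := by
  obtain ⟨B, hBind, hBspan, -⟩ := (isPregeometry_ecl_union S).exists_indepFamilyOver ∅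
  have hBspan' : ecl (S ∪ B) = Set.univ := by
    have : (fun C : Set M => ecl (S ∪ C)) (∅ ∪ B) = Set.univ := hBspan
    dsimp only at this
    rwa [Set.empty_union] at this
  have hBinf : B.Infinite := by
    intro hfin
    obtain ⟨d, hd⟩ := hinf (S ∪ B) (hS.union hfin)
    apply hd
    rw [hBspan']
    exact Set.mem_univ d
  haveI : Infinite B := hBinf.to_subtype
  haveI : Countable B := inferInstance
  have h₁ : #(ℕ ⊕ (ℕ ⊕ ℕ)) = ℵ₀ := Cardinal.mk_eq_aleph0 _
  have h₂ : #B = ℵ₀ := Cardinal.mk_eq_aleph0 _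
  obtain ⟨e⟩ := Cardinal.eq.1 (h₁.trans h₂.symm)
  refine ⟨((↑) : B → M) ∘ e, indepFamilyOver_comp_injective hBind e.injective, ?_⟩
  rw [e.surjective.range_comp, Subtype.range_coe]
  exact hBspan'

end Basis

/-! ### The chart -/

section Chart

variable [CharZero M] [IsAlgClosed M] [Countable M] [Γ : OrbitGroup M] {S : Set M}

/-- **The quasiminimal chart of a countable SEAC model** (Bays–Kirby 2018, Thm 6.9 with Fact 6.4):
a countable algebraically closed exponential field with surjective `exp`, strongly
exponentially-algebraically closed and infinite dimensional, carries the data `Setup` of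
`ContinuumModel.lean` — a weakly quasiminimal pregeometry structure for `C ↦ ecl (S ∪ C)` in the
orbit language of `Aut(M / ecl S)`, a basis indexed by `ℕ ⊕ (ℕ ⊕ ℕ)`, partial embeddings are
E-ring endomorphisms, and conjugate tuples have equal `(+, ·, exp)`-quantifier-free types.
[cite: BaysKirby2018ANT, Thm 6.9 and Fact 6.4] -/
theorem nonempty_orbitSetup (hΓ : Γ.G = baseAut S) (hS : S.Finite)
    (hsurj : IsSurjectiveOntoUnits M) (hSEAC : IsStronglyExpAlgClosed M)
    (hinf : ∀ C : Set M, C.Finite → ∃ d, d ∉ ecl C) :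
    Nonempty (Setup (orbitLanguage M) M (fun C : Set M => ecl (S ∪ C))) := by
  obtain ⟨b, hb, hspan⟩ := exists_orbitBasis hS hinf
  exact ⟨{ b := b
           countable := inferInstance
           isWQPS := isWeaklyQuasiminimalPregeometryStructure_orbit hΓ hS hsurj hSEAC hinf
           indep := hb
           span := hspan
           hom_of_isQFEmbOn := fun σ hσ => exists_expRingHom_of_isQFEmbOn hΓ.le hσ
           expRing_of_eqQFType := fun x y h => expRing_eqQFType_of_eqQFType hΓ.le h }⟩

end Chart

end SEACModel

/-! ### Zilber's existence theorem from one countable model -/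

/-- **Zilber 2005, Thm 1.1 (existence), from one countable model** — the passage
"`M(SK)` (Thm 5.9) ⟹ quasiminimal pregeometry structure (Thm 6.9) ⟹ models of all uncountable
cardinalities (Fact 6.4 = Kirby 2010, Thm 4.2) ⟹ their axioms (Thm 8.2) ⟹ `ECF_{SK,CCP}`
(Thm 9.1)" of Bays–Kirby 2018: if there is a countable algebraically closed exponential field
with surjective `exp`, standard kernel, the Schanuel property, strong exponential-algebraic
closedness and infinite `ecl`-dimension, then there is a Zilber field of every uncountable
cardinality. [cite: Zilber2005, Thm 1.1] [cite: BaysKirby2018ANT, Thm 6.9, Fact 6.4, Thm 8.2, Thm 9.1] -/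
theorem exists_isZilberField_of_aleph0_lt_of_countable {M : Type} [Field M] [CharZero M]
    [IsAlgClosed M] [Literature.ModelTheory.ExponentialFields.ExponentialRing M] [Countable M]
    (hsurj : IsSurjectiveOntoUnits M) (hstd : HasStandardKernel M) (hSP : SchanuelProperty M)
    (hSEAC : IsStronglyExpAlgClosed M) (hinf : ∀ C : Set M, C.Finite → ∃ d, d ∉ ecl C) :
    exists_isZilberField_of_aleph0_lt := by
  letI Γ : OrbitGroup M := ⟨SEACModel.baseAut (∅ : Set M)⟩
  obtain ⟨St⟩ := SEACModel.nonempty_orbitSetup (Γ := Γ) (S := (∅ : Set M)) rfl Set.finite_empty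
    hsurj hSEAC hinf
  exact exists_isZilberField_of_aleph0_lt_of_orbitSetup (Γ := Γ) (S₀ := (∅ : Set M)) le_rfl St
    hstd hsurj hSP hSEAC (fun A => SEACModel.ecl_subset_ecl_union' ∅ A)

end Literature.NumberTheory.Transcendental

end
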